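/-
Copyright (c) 2026 the pub-hodgecm-mathlib formalisation cell (harness21).  Prover seat hodgecm-mathlib-K2E3-p14 (g9) (E3 hand on strike line L1; U1 stage-3 plan of record
M-158q (4); desk word (Q2) to LH7-p05 (g2)'s (P-i) SIG 2026-09-04T23:05:58Z), Track B «K2-LIT» ∕ hLiu418 = stmt-HodgeConjecture-24832: THE (CR) PAIR READING
«`resGen` of the family `f_μ − I·f_σ` vanishes ⇒ `resGen f_μ = I · resGen f_σ`» — ★ B3 `K2LiuResidueGenFinsetSum` over `Fin 2` with coefficients `(1, −I)`.  THEOREMS ONLY.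
-/
import Summits.HodgeConjecture.HodgeConjecture.Theorems.K2LiuResidueGenFinsetSum   -- ★ B3 (this seat, p862768): `resGen_finset_sum`; brings ★ U0 `resGen`
import HarnessLib

/-!
# Crux `HLiu418`, organ U1-CT-ind STAGE 3 («U1-glob») → (P-i)'s (CR) letter: THE CAUCHY–RIEMANN PAIR READING OF A VANISHING RESIDUE
# «`f = f_μ − I·f_σ` (pointwise), `resGen hex_f = 0` ⇒ `resGen hex_μ h = I · resGen hex_σ h`»   [KudlaRallis1994 §1 Thm. 1.1; Liu2021 Lem. B.12]

Cell `hodgecm-mathlib`, crux item hLiu418 = `stmt-HodgeConjecture-24832`; squad K2, strike line L1, LEAD F0P6-plan (g14); prover K2E3-p14 (g9) (U1 stage-3 lead, desk of (P-i)).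
Lane `--supports stmt-HodgeConjecture-24832 --as helper` (count-neutral).  THEOREMS ONLY (no `def`, no `instance`, no notation, no named-fact hypothesis, no `sorry`).  GENERIC in
the doubled datum `(e, dV, dW)`, the rank `n` and the families.

THE POINT.  LH7-p05 (g2)'s pool file (P-i) `K2LiuFirstTermHolCutResidueType` states the (CR) face of ★ `holCutRows_of_descentLetters`' `hgen` block BY VALUE as
`hCR : resGen (hex₁ x Xμ hXμ) (·) = I * resGen (hex₁ x Xσ hXσ) (·)` on the residues of the two REAL derived families along `Xμ`, `Xσ` (desk «=» 23:05:58Z).  U1-glob stage 3 pays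
the COMPLEX family: for `Y = Xμ − I·Xσ ∈ 𝔭⁻_σ` the section `ω(Y)(v_G ⊗ f)` has its arch component in `ker N*_σ(½)` (★ `K2LiuArchIntertwiningScalarKernel` + ★ `JunctionPMinusWeilDatum`),
so the END head B4 gives `resGen = 0` for the family `f_Y = f_μ − I·f_σ`.  THIS FILE is the 30-line bridge between the two currencies — ★ B3 `resGen_finset_sum` over `Fin 2` with
coefficients `![1, −I]` and families `![f_μ, f_σ]`:
* `eq_sum_two_of_pointwise` (the pointwise hypothesis `f s h = f_μ s h − I·f_σ s h` as `f = Σ_{j : Fin 2} c_j • g_j`);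
* **`resGen_pair_eq`** — `resGen hex h = resGen hexμ h − I · resGen hexσ h`;
* **`resGen_eq_I_mul_of_resGen_sub_eq_zero`** — `resGen hex = 0 ⇒ resGen hexμ h = I · resGen hexσ h` (the `hCR` letter; if the frame has `Xμ + I·Xσ ∈ 𝔭⁻`, use it with
  `f_σ ↦ −f_σ`, or read `… = −I · …` from `resGen_pair_eq`).
References: [KudlaRallis1994] S. Kudla, S. Rallis, Ann. of Math. 140 (1994), §1 Thm. 1.1; [Liu2021] Y. Liu, Invent. Math. (2021), App. B Lem. B.12 pp. 103–104;
[MoeglinWaldspurger1995] C. Mœglin, J.-L. Waldspurger, CUP (1995), IV.1.9–IV.1.11.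
HONEST LABEL.  Count-neutral helper: `HC_CM` is proved only modulo the 7 printed citations (2 remaining named inputs: hLiu418 = `stmt-HodgeConjecture-24832`,
h413 = `stmt-HodgeConjecture-24833`) until rung 0 closes; (CR) stays OPEN by value until B4 + B5 land.
-/

set_option autoImplicit false
set_option linter.dupNamespace false -- the mandated namespace repeats `HodgeConjecture.HodgeConjecture`

noncomputable section

open scoped Topology BigOperators
open Filter NumberField IsDedekindDomain Complex
open Literature.NumberTheory.Automorphic Literature.NumberTheory.GaloisRepresentations
open Literature.NumberTheory.GelbartRogawski1991 Literature.NumberTheory.GelbartRogawski1991.GRConstruction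
open Literature.NumberTheory.K2Lit.SiegelDoubled

namespace Summit.HodgeConjecture.HodgeConjecture.Cruxes.HLiu418.K2LiuResGenCauchyRiemannPair

open Summit.HodgeConjecture.HodgeConjecture.Cruxes.HLiu418.K2LiuFirstTermResidueFormDefs
open Summit.HodgeConjecture.HodgeConjecture.Cruxes.HLiu418.K2LiuFirstTermResidueGenDefs
open Summit.HodgeConjecture.HodgeConjecture.Cruxes.HLiu418.K2LiuResidueGenFinsetSum (resGen_finset_sum)

variable (L : Type) [Field L] [NumberField L] [IsCMField L]
variable {N M n : ℕ} (e : Fin N × Fin M ≃ Fin n)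
  (dV : Fin N → L) (hdV : ∀ i, IsCMField.complexConj L (dV i) = dV i) (hdV0 : ∀ i, dV i ≠ 0)
  (dW : Fin M → L) (hdW : ∀ i, IsCMField.complexConj L (dW i) = dW i) (hdW0 : ∀ i, dW i ≠ 0)

omit [NumberField L] [IsCMField L] in
/-- the pointwise Cauchy–Riemann combination as a `Fin 2` linear combination: `f = Σ_j ![1, −I] j • ![f_μ, f_σ] j`. [folklore] -/
theorem eq_sum_two_of_pointwise {X : Type*} (f fμ fσ : ℂ → X → ℂ) (hf : ∀ s x, f s x = fμ s x - Complex.I * fσ s x) :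
    f = ∑ j : Fin 2, (![(1 : ℂ), -Complex.I] j) • (![fμ, fσ] j) := by
  funext s x
  rw [hf s x, Fin.sum_univ_two]
  simp only [Matrix.cons_val_zero, Matrix.cons_val_one, Pi.add_apply, Pi.smul_apply, smul_eq_mul, one_mul]
  ring

/-- `resGen` along EQUAL families agree (the packages are proofs of the same proposition after `subst`). [folklore] -/
theorem resGen_family_congr {f g : ℂ → HA L e dV hdV dW hdW → ℂ} (hfg : f = g)
    (hexf : ∃ (P : Finset ℂ) (Es : ℂ → HA L e dV hdV dW hdW → ℂ),
      (∀ h : HA L e dV hdV dW hdW, DifferentiableOn ℂ (fun s => Es s h) {s : ℂ | 0 < s.re}) ∧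
      (∀ s : ℂ, 0 < s.re → Continuous (Es s)) ∧
      (∀ s : ℂ, 0 < s.re → ∀ (γ : ratH L e dV hdV dW hdW) (h : HA L e dV hdV dW hdW),
        Es s ((γ : HA L e dV hdV dW hdW) * h) = Es s h) ∧
      (∀ (s : ℂ) (h : HA L e dV hdV dW hdW), (n : ℝ) / 2 < s.re →
        Es s h = (∏ p ∈ P, (s - p)) * eisensteinFamilyDelta L e dV hdV dW hdW f s h) ∧
      (∀ z : ℂ, 0 < z.re → ∃ C A r : ℝ, 0 < r ∧ ∀ s : ℂ, dist s z < r → ∀ h : HA L e dV hdV dW hdW,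
        ‖Es s h‖ ≤ C * adelicHeightGL (n + n) L (h : GL (Fin (n + n)) (AdeleRing (𝓞 L) L)) ^ A))
    (hexg : ∃ (P : Finset ℂ) (Es : ℂ → HA L e dV hdV dW hdW → ℂ),
      (∀ h : HA L e dV hdV dW hdW, DifferentiableOn ℂ (fun s => Es s h) {s : ℂ | 0 < s.re}) ∧
      (∀ s : ℂ, 0 < s.re → Continuous (Es s)) ∧
      (∀ s : ℂ, 0 < s.re → ∀ (γ : ratH L e dV hdV dW hdW) (h : HA L e dV hdV dW hdW),
        Es s ((γ : HA L e dV hdV dW hdW) * h) = Es s h) ∧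
      (∀ (s : ℂ) (h : HA L e dV hdV dW hdW), (n : ℝ) / 2 < s.re →
        Es s h = (∏ p ∈ P, (s - p)) * eisensteinFamilyDelta L e dV hdV dW hdW g s h) ∧
      (∀ z : ℂ, 0 < z.re → ∃ C A r : ℝ, 0 < r ∧ ∀ s : ℂ, dist s z < r → ∀ h : HA L e dV hdV dW hdW,
        ‖Es s h‖ ≤ C * adelicHeightGL (n + n) L (h : GL (Fin (n + n)) (AdeleRing (𝓞 L) L)) ^ A)) :
    resGen hexf = resGen hexg := by
  subst hfg
  rfl

include hdV0 hdW0 in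
/-- **THE PAIR READING OF `resGen`**: for continuous Siegel section families `f_μ`, `f_σ` (unitary `χ`) and `f = f_μ − I·f_σ` pointwise, `resGen hex h = resGen hexμ h − I·resGen hexσ h`
(★ B3 `resGen_finset_sum` over `Fin 2`). [cite: KudlaRallis1994, §1 Thm. 1.1] [cite: Liu2021, Lem. B.12 pp. 103–104] -/
theorem resGen_pair_eq (χ : HeckeCharacter L) (hχ : χ.IsUnitary) (fμ fσ : ℂ → HA L e dV hdV dW hdW → ℂ)
    (hμ : ∀ s, IsSiegelDeltaSection L e dV hdV dW hdW χ s (fμ s)) (hμc : ∀ s, Continuous (fμ s))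
    (hσ : ∀ s, IsSiegelDeltaSection L e dV hdV dW hdW χ s (fσ s)) (hσc : ∀ s, Continuous (fσ s))
    {f : ℂ → HA L e dV hdV dW hdW → ℂ} (hf : ∀ s h, f s h = fμ s h - Complex.I * fσ s h)
    (hex : ∃ (P : Finset ℂ) (Es : ℂ → HA L e dV hdV dW hdW → ℂ),
      (∀ h : HA L e dV hdV dW hdW, DifferentiableOn ℂ (fun s => Es s h) {s : ℂ | 0 < s.re}) ∧
      (∀ s : ℂ, 0 < s.re → Continuous (Es s)) ∧
      (∀ s : ℂ, 0 < s.re → ∀ (γ : ratH L e dV hdV dW hdW) (h : HA L e dV hdV dW hdW),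
        Es s ((γ : HA L e dV hdV dW hdW) * h) = Es s h) ∧
      (∀ (s : ℂ) (h : HA L e dV hdV dW hdW), (n : ℝ) / 2 < s.re →
        Es s h = (∏ p ∈ P, (s - p)) * eisensteinFamilyDelta L e dV hdV dW hdW f s h) ∧
      (∀ z : ℂ, 0 < z.re → ∃ C A r : ℝ, 0 < r ∧ ∀ s : ℂ, dist s z < r → ∀ h : HA L e dV hdV dW hdW,
        ‖Es s h‖ ≤ C * adelicHeightGL (n + n) L (h : GL (Fin (n + n)) (AdeleRing (𝓞 L) L)) ^ A))
    (hexμ : ∃ (P : Finset ℂ) (Es : ℂ → HA L e dV hdV dW hdW → ℂ),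
      (∀ h : HA L e dV hdV dW hdW, DifferentiableOn ℂ (fun s => Es s h) {s : ℂ | 0 < s.re}) ∧
      (∀ s : ℂ, 0 < s.re → Continuous (Es s)) ∧
      (∀ s : ℂ, 0 < s.re → ∀ (γ : ratH L e dV hdV dW hdW) (h : HA L e dV hdV dW hdW),
        Es s ((γ : HA L e dV hdV dW hdW) * h) = Es s h) ∧
      (∀ (s : ℂ) (h : HA L e dV hdV dW hdW), (n : ℝ) / 2 < s.re →
        Es s h = (∏ p ∈ P, (s - p)) * eisensteinFamilyDelta L e dV hdV dW hdW fμ s h) ∧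
      (∀ z : ℂ, 0 < z.re → ∃ C A r : ℝ, 0 < r ∧ ∀ s : ℂ, dist s z < r → ∀ h : HA L e dV hdV dW hdW,
        ‖Es s h‖ ≤ C * adelicHeightGL (n + n) L (h : GL (Fin (n + n)) (AdeleRing (𝓞 L) L)) ^ A))
    (hexσ : ∃ (P : Finset ℂ) (Es : ℂ → HA L e dV hdV dW hdW → ℂ),
      (∀ h : HA L e dV hdV dW hdW, DifferentiableOn ℂ (fun s => Es s h) {s : ℂ | 0 < s.re}) ∧
      (∀ s : ℂ, 0 < s.re → Continuous (Es s)) ∧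
      (∀ s : ℂ, 0 < s.re → ∀ (γ : ratH L e dV hdV dW hdW) (h : HA L e dV hdV dW hdW),
        Es s ((γ : HA L e dV hdV dW hdW) * h) = Es s h) ∧
      (∀ (s : ℂ) (h : HA L e dV hdV dW hdW), (n : ℝ) / 2 < s.re →
        Es s h = (∏ p ∈ P, (s - p)) * eisensteinFamilyDelta L e dV hdV dW hdW fσ s h) ∧
      (∀ z : ℂ, 0 < z.re → ∃ C A r : ℝ, 0 < r ∧ ∀ s : ℂ, dist s z < r → ∀ h : HA L e dV hdV dW hdW,
        ‖Es s h‖ ≤ C * adelicHeightGL (n + n) L (h : GL (Fin (n + n)) (AdeleRing (𝓞 L) L)) ^ A))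
    (h : HA L e dV hdV dW hdW) :
    resGen hex h = resGen hexμ h - Complex.I * resGen hexσ h := by
  have hexg : ∀ j : Fin 2, ∃ (P : Finset ℂ) (Es : ℂ → HA L e dV hdV dW hdW → ℂ),
      (∀ h : HA L e dV hdV dW hdW, DifferentiableOn ℂ (fun s => Es s h) {s : ℂ | 0 < s.re}) ∧
      (∀ s : ℂ, 0 < s.re → Continuous (Es s)) ∧
      (∀ s : ℂ, 0 < s.re → ∀ (γ : ratH L e dV hdV dW hdW) (h : HA L e dV hdV dW hdW),
        Es s ((γ : HA L e dV hdV dW hdW) * h) = Es s h) ∧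
      (∀ (s : ℂ) (h : HA L e dV hdV dW hdW), (n : ℝ) / 2 < s.re →
        Es s h = (∏ p ∈ P, (s - p)) * eisensteinFamilyDelta L e dV hdV dW hdW (![fμ, fσ] j) s h) ∧
      (∀ z : ℂ, 0 < z.re → ∃ C A r : ℝ, 0 < r ∧ ∀ s : ℂ, dist s z < r → ∀ h : HA L e dV hdV dW hdW,
        ‖Es s h‖ ≤ C * adelicHeightGL (n + n) L (h : GL (Fin (n + n)) (AdeleRing (𝓞 L) L)) ^ A) := by
    intro j
    fin_cases j
    · exact hexμ
    · exact hexσ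
  have key := resGen_finset_sum L e dV hdV hdV0 dW hdW hdW0 χ hχ (![(1 : ℂ), -Complex.I]) (![fμ, fσ])
    (fun j => by fin_cases j <;> assumption) (fun j => by fin_cases j <;> assumption) (eq_sum_two_of_pointwise f fμ fσ hf) hex hexg
  rw [congr_fun key h, Fin.sum_univ_two,
    resGen_family_congr L e dV hdV dW hdW (rfl : (![fμ, fσ] : Fin 2 → ℂ → HA L e dV hdV dW hdW → ℂ) 0 = fμ) (hexg 0) hexμ,
    resGen_family_congr L e dV hdV dW hdW (rfl : (![fμ, fσ] : Fin 2 → ℂ → HA L e dV hdV dW hdW → ℂ) 1 = fσ) (hexg 1) hexσ]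
  simp only [Matrix.cons_val_zero, Matrix.cons_val_one]
  ring

include hdV0 hdW0 in
/-- **THE (CR) LETTER FROM A VANISHING RESIDUE**: with `f = f_μ − I·f_σ` pointwise and `resGen hex = 0` (U1-glob's END head on the `𝔭⁻_σ` family), `resGen hexμ h = I·resGen hexσ h`
— (P-i)'s `hCR` by value. [cite: KudlaRallis1994, §1 Thm. 1.1] [cite: MoeglinWaldspurger1995, IV.1.9–IV.1.11] -/
theorem resGen_eq_I_mul_of_resGen_sub_eq_zero (χ : HeckeCharacter L) (hχ : χ.IsUnitary) (fμ fσ : ℂ → HA L e dV hdV dW hdW → ℂ)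
    (hμ : ∀ s, IsSiegelDeltaSection L e dV hdV dW hdW χ s (fμ s)) (hμc : ∀ s, Continuous (fμ s))
    (hσ : ∀ s, IsSiegelDeltaSection L e dV hdV dW hdW χ s (fσ s)) (hσc : ∀ s, Continuous (fσ s))
    {f : ℂ → HA L e dV hdV dW hdW → ℂ} (hf : ∀ s h, f s h = fμ s h - Complex.I * fσ s h)
    (hex : ∃ (P : Finset ℂ) (Es : ℂ → HA L e dV hdV dW hdW → ℂ),
      (∀ h : HA L e dV hdV dW hdW, DifferentiableOn ℂ (fun s => Es s h) {s : ℂ | 0 < s.re}) ∧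
      (∀ s : ℂ, 0 < s.re → Continuous (Es s)) ∧
      (∀ s : ℂ, 0 < s.re → ∀ (γ : ratH L e dV hdV dW hdW) (h : HA L e dV hdV dW hdW),
        Es s ((γ : HA L e dV hdV dW hdW) * h) = Es s h) ∧
      (∀ (s : ℂ) (h : HA L e dV hdV dW hdW), (n : ℝ) / 2 < s.re →
        Es s h = (∏ p ∈ P, (s - p)) * eisensteinFamilyDelta L e dV hdV dW hdW f s h) ∧
      (∀ z : ℂ, 0 < z.re → ∃ C A r : ℝ, 0 < r ∧ ∀ s : ℂ, dist s z < r → ∀ h : HA L e dV hdV dW hdW,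
        ‖Es s h‖ ≤ C * adelicHeightGL (n + n) L (h : GL (Fin (n + n)) (AdeleRing (𝓞 L) L)) ^ A))
    (hexμ : ∃ (P : Finset ℂ) (Es : ℂ → HA L e dV hdV dW hdW → ℂ),
      (∀ h : HA L e dV hdV dW hdW, DifferentiableOn ℂ (fun s => Es s h) {s : ℂ | 0 < s.re}) ∧
      (∀ s : ℂ, 0 < s.re → Continuous (Es s)) ∧
      (∀ s : ℂ, 0 < s.re → ∀ (γ : ratH L e dV hdV dW hdW) (h : HA L e dV hdV dW hdW),
        Es s ((γ : HA L e dV hdV dW hdW) * h) = Es s h) ∧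
      (∀ (s : ℂ) (h : HA L e dV hdV dW hdW), (n : ℝ) / 2 < s.re →
        Es s h = (∏ p ∈ P, (s - p)) * eisensteinFamilyDelta L e dV hdV dW hdW fμ s h) ∧
      (∀ z : ℂ, 0 < z.re → ∃ C A r : ℝ, 0 < r ∧ ∀ s : ℂ, dist s z < r → ∀ h : HA L e dV hdV dW hdW,
        ‖Es s h‖ ≤ C * adelicHeightGL (n + n) L (h : GL (Fin (n + n)) (AdeleRing (𝓞 L) L)) ^ A))
    (hexσ : ∃ (P : Finset ℂ) (Es : ℂ → HA L e dV hdV dW hdW → ℂ),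
      (∀ h : HA L e dV hdV dW hdW, DifferentiableOn ℂ (fun s => Es s h) {s : ℂ | 0 < s.re}) ∧
      (∀ s : ℂ, 0 < s.re → Continuous (Es s)) ∧
      (∀ s : ℂ, 0 < s.re → ∀ (γ : ratH L e dV hdV dW hdW) (h : HA L e dV hdV dW hdW),
        Es s ((γ : HA L e dV hdV dW hdW) * h) = Es s h) ∧
      (∀ (s : ℂ) (h : HA L e dV hdV dW hdW), (n : ℝ) / 2 < s.re →
        Es s h = (∏ p ∈ P, (s - p)) * eisensteinFamilyDelta L e dV hdV dW hdW fσ s h) ∧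
      (∀ z : ℂ, 0 < z.re → ∃ C A r : ℝ, 0 < r ∧ ∀ s : ℂ, dist s z < r → ∀ h : HA L e dV hdV dW hdW,
        ‖Es s h‖ ≤ C * adelicHeightGL (n + n) L (h : GL (Fin (n + n)) (AdeleRing (𝓞 L) L)) ^ A))
    (h0 : resGen hex = 0) (h : HA L e dV hdV dW hdW) :
    resGen hexμ h = Complex.I * resGen hexσ h := by
  have key := resGen_pair_eq L e dV hdV hdV0 dW hdW hdW0 χ hχ fμ fσ hμ hμc hσ hσc hf hex hexμ hexσ h
  rw [h0, Pi.zero_apply] at key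
  linear_combination -key

end Summit.HodgeConjecture.HodgeConjecture.Cruxes.HLiu418.K2LiuResGenCauchyRiemannPair

end
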